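import Mathlib
import HarnessLib
import Summits.CriticalPhenomena.CardyFormulaZ2.Theses.CardyMagicRigidity
import Summits.CriticalPhenomena.CardyFormulaZ2.Theorems.CardyMagicRigidityTransferContinuityReduction
import Summits.CriticalPhenomena.CardyFormulaZ2.Theorems.CardyMagicRigidityMagicFormulaTSmearedCentring
import Summits.CriticalPhenomena.CardyFormulaZ2.Theorems.CardyMagicRigidityMagicFormulaTExistenceIdentification
import Summits.CriticalPhenomena.CardyFormulaZ2.Theorems.CardyMagicRigidityMagicFormulaTStubEntire
import Summits.CriticalPhenomena.CardyFormulaZ2.Theorems.CardyMagicRigidityMagicFormulaTStubNormalFamily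
import Summits.CriticalPhenomena.CardyFormulaZ2.Theorems.CardyMagicRigidityMagicFormulaTStubTaylorLimit
import Summits.CriticalPhenomena.CardyFormulaZ2.Theorems.CardyMagicRigidityMagicFormulaTStubVitaliCoeff
import Literature.Probability.RandomPlanarGeometry.NestingTransform
import Literature.Probability.Percolation.FullPlaneCNL
import Literature.Probability.Percolation.TriCorrLengthExponentDecomposition

/-!
# Line `Sketch` (v8) for crux `MagicFormulaT`: the coefficient residue

Crux `Summit.CriticalPhenomena.CardyFormulaZ2.Theses.CardyMagicRigidity.MagicFormulaT`
(stmt-CriticalPhenomena-4836), line `Sketch`, registered skeleton v8, sub-goal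
`cf_magicFormulaT_iff_coefficients`: **the crux is EQUIVALENT to the identification, in the limit
`δ → 0⁺`, of the Taylor coefficients of orders `≥ 2` at `t = 0` of the complex-coupling transform
`Φ_δ(t) = E_{1/2}[∏_u 2cos(t·θ_u(f) + π/3)]` with those of the Gaussian `G_f(t) = exp(q(f) t²)`,
`q(f) = (3/4π²) ∬ log‖x−y‖ f(x) f(y)`**, for every admissible density `f`.

* `←`: orders `0` (`Φ_δ(0) = 1`, `stub_entire`) and `1` (exact centring, `smearedCentring`) are
  identified at every mesh; with the hypothesis at orders `≥ 2`, coefficientwise convergence of the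
  normal family (`stub_entire`, `stub_normalFamily`) is convergence (`stub_taylorLimit`), so
  `Φ_δ(1) → G_f(1) = G(f)`; at the real coupling `t = 1` this is the crux's expectation
  (`stub_entire`'s real identity, `Theorems.integral_site_eq`), and real parts conclude.
* `→`: for real `t` the density `t·f` is admissible and `q(t·f) = t² q(f)`, so the crux applied to
  `t·f` gives `Φ_δ(t) → G_f(t)` at every REAL `t`.  The difference `D_δ = Φ_δ − G_f` is then a normal
  family of entire functions tending to `0` on the real axis; by the quantitative order-`0` step of
  `stub_vitaliCoeff` (Schwarz bound `vitaliCoeff_norm_dslope_le` on the divided differences) all its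
  iterated divided differences at `0`, hence all its Taylor coefficients
  (`vitaliCoeff_iteratedDeriv_eq`), tend to `0` (`cfi_tendsto_iteratedDeriv_zero`), i.e.
  `Φ_δ^{(k)}(0) → G_f^{(k)}(0)` for every `k`.

The two published leaves `exists_isFullPlaneCNLLaw` (Camia–Newman) and
`SmirnovWerner2001_fourArm_scalingLimit` (Smirnov–Werner) are hypotheses of the registered signature;
the proof does not use them (both directions are unconditional).  Pure glue over landed material; no
named fact is used; no definition is introduced.
-/

noncomputable section

namespace Summit.CriticalPhenomena.CardyFormulaZ2.Cruxes.MagicFormulaT.LineSketch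

open MeasureTheory Filter Set Function
open scoped Real Topology BigOperators ENNReal
open Literature.Probability.RandomPlanarGeometry Literature.Probability.Percolation
  Literature.Probability.LatticeModels

/-! ## Complex analysis: a normal family vanishing in the limit on the real axis has vanishing
coefficient limits -/

/-- **Order `0`, quantitative form.**  Let `G δ : ℂ → ℂ` be entire for all small `δ > 0`, bounded
on every closed ball eventually in `δ`, and `G δ t → 0` as `δ → 0⁺` for every real `t ≠ 0`.  Then
`G δ 0 → 0`.  Proof: `G δ 0` has a limit `L` (`vitaliCoeff_tendsto_zero`); the Schwarz bound
`vitaliCoeff_norm_dslope_le` gives `‖G δ t − G δ 0‖ ≤ M t` for real `0 < t ≤ 1` eventually in `δ`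
(`M` a bound on `‖t‖ ≤ 2`), so `‖L‖ ≤ M t` for every such `t`, whence `L = 0`. -/
theorem cfi_tendsto_zero_origin {G : ℝ → ℂ → ℂ}
    (hd : ∀ᶠ δ in 𝓝[>] (0 : ℝ), Differentiable ℂ (G δ))
    (hb : ∀ ρ : ℝ, 0 < ρ → ∃ M : ℝ, ∀ᶠ δ in 𝓝[>] (0 : ℝ), ∀ t : ℂ, ‖t‖ ≤ ρ → ‖G δ t‖ ≤ M)
    (hc : ∀ t : ℝ, t ≠ 0 → Tendsto (fun δ ↦ G δ (t : ℂ)) (𝓝[>] (0 : ℝ)) (𝓝 0)) :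
    Tendsto (fun δ ↦ G δ 0) (𝓝[>] (0 : ℝ)) (𝓝 0) := by
  obtain ⟨L, hL⟩ := vitaliCoeff_tendsto_zero hd hb fun t ht ↦ ⟨0, hc t ht⟩
  suffices hL0 : L = 0 by rwa [hL0] at hL
  obtain ⟨M, hM⟩ := hb (2 * 1) (by norm_num)
  -- for every real `0 < t ≤ 1`: `‖L‖ ≤ M * t`
  have hle : ∀ t : ℝ, 0 < t → t ≤ 1 → ‖L‖ ≤ M * t := by
    intro t ht ht1
    have hnorm : ‖(t : ℂ)‖ = t := by
      rw [Complex.norm_real, Real.norm_eq_abs, abs_of_pos ht]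
    have hev : ∀ᶠ δ in 𝓝[>] (0 : ℝ), ‖G δ (t : ℂ) - G δ 0‖ ≤ M * t := by
      filter_upwards [hd, hM] with δ hdδ hMδ
      have h1 : ‖dslope (G δ) 0 t‖ ≤ M / 1 :=
        vitaliCoeff_norm_dslope_le hdδ one_pos hMδ (t : ℂ) (hnorm.le.trans ht1)
      have h3 : G δ t - G δ 0 = ((t : ℂ) - 0) • dslope (G δ) 0 t :=
        (sub_smul_dslope (G δ) 0 t).symm
      rw [div_one] at h1
      rw [h3, sub_zero, norm_smul, hnorm, mul_comm]
      exact mul_le_mul_of_nonneg_right h1 ht.le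
    have hlim : Tendsto (fun δ ↦ ‖G δ (t : ℂ) - G δ 0‖) (𝓝[>] (0 : ℝ)) (𝓝 ‖(0 : ℂ) - L‖) :=
      ((hc t ht.ne').sub hL).norm
    have h := le_of_tendsto hlim hev
    rwa [zero_sub, norm_neg] at h
  -- let `t → 0⁺`
  have h0 : ‖L‖ ≤ 0 := by
    have ht : Tendsto (fun t : ℝ ↦ M * t) (𝓝[>] (0 : ℝ)) (𝓝 (M * 0)) :=
      tendsto_nhdsWithin_of_tendsto_nhds ((continuous_const.mul continuous_id).tendsto 0)
    rw [mul_zero] at ht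
    refine ge_of_tendsto ht ?_
    filter_upwards [Ioc_mem_nhdsGT one_pos] with t ht'
    exact hle t ht'.1 ht'.2
  exact norm_le_zero_iff.1 h0

/-- **Induction step.**  If the family `G δ` is entire eventually, bounded on every closed ball
eventually, and tends to `0` at every real `t ≠ 0` (as `δ → 0⁺`), then so does the family of
divided differences `dslope (G δ) 0`: the first two by `vitaliCoeff_dslope_package`, the third
because `dslope (G δ) 0 t = t⁻¹ • (G δ t − G δ 0)` and `G δ 0 → 0` (`cfi_tendsto_zero_origin`). -/
theorem cfi_dslope_package {G : ℝ → ℂ → ℂ}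
    (hd : ∀ᶠ δ in 𝓝[>] (0 : ℝ), Differentiable ℂ (G δ))
    (hb : ∀ ρ : ℝ, 0 < ρ → ∃ M : ℝ, ∀ᶠ δ in 𝓝[>] (0 : ℝ), ∀ t : ℂ, ‖t‖ ≤ ρ → ‖G δ t‖ ≤ M)
    (hc : ∀ t : ℝ, t ≠ 0 → Tendsto (fun δ ↦ G δ (t : ℂ)) (𝓝[>] (0 : ℝ)) (𝓝 0)) :
    (∀ᶠ δ in 𝓝[>] (0 : ℝ), Differentiable ℂ (dslope (G δ) 0)) ∧
    (∀ ρ : ℝ, 0 < ρ → ∃ M : ℝ, ∀ᶠ δ in 𝓝[>] (0 : ℝ), ∀ t : ℂ, ‖t‖ ≤ ρ →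
      ‖dslope (G δ) 0 t‖ ≤ M) ∧
    (∀ t : ℝ, t ≠ 0 → Tendsto (fun δ ↦ dslope (G δ) 0 (t : ℂ)) (𝓝[>] (0 : ℝ)) (𝓝 0)) := by
  obtain ⟨hd', hb', -⟩ := vitaliCoeff_dslope_package hd hb fun t ht ↦ ⟨0, hc t ht⟩
  refine ⟨hd', hb', fun t ht ↦ ?_⟩
  have h0 := cfi_tendsto_zero_origin hd hb hc
  have ht' : (t : ℂ) ≠ 0 := by exact_mod_cast ht
  have heq : (fun δ ↦ dslope (G δ) 0 (t : ℂ)) =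
      fun δ ↦ ((t : ℂ) - 0)⁻¹ • (G δ t - G δ 0) := by
    funext δ
    rw [dslope_of_ne _ ht', slope_def_module]
  rw [heq]
  simpa using ((hc t ht).sub h0).const_smul (((t : ℂ) - 0)⁻¹)

/-- **All iterates.**  Under the same hypotheses on `G δ`, every iterated divided difference
`(swap dslope 0)^[k] (G δ)` is entire eventually, bounded on every closed ball eventually, and
tends to `0` at every real `t ≠ 0`; induction on `k` with `cfi_dslope_package`. -/
theorem cfi_iterate_package {G : ℝ → ℂ → ℂ}
    (hd : ∀ᶠ δ in 𝓝[>] (0 : ℝ), Differentiable ℂ (G δ))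
    (hb : ∀ ρ : ℝ, 0 < ρ → ∃ M : ℝ, ∀ᶠ δ in 𝓝[>] (0 : ℝ), ∀ t : ℂ, ‖t‖ ≤ ρ → ‖G δ t‖ ≤ M)
    (hc : ∀ t : ℝ, t ≠ 0 → Tendsto (fun δ ↦ G δ (t : ℂ)) (𝓝[>] (0 : ℝ)) (𝓝 0)) (k : ℕ) :
    (∀ᶠ δ in 𝓝[>] (0 : ℝ), Differentiable ℂ ((swap dslope (0 : ℂ))^[k] (G δ))) ∧
    (∀ ρ : ℝ, 0 < ρ → ∃ M : ℝ, ∀ᶠ δ in 𝓝[>] (0 : ℝ), ∀ t : ℂ, ‖t‖ ≤ ρ →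
      ‖(swap dslope (0 : ℂ))^[k] (G δ) t‖ ≤ M) ∧
    (∀ t : ℝ, t ≠ 0 →
      Tendsto (fun δ ↦ (swap dslope (0 : ℂ))^[k] (G δ) (t : ℂ)) (𝓝[>] (0 : ℝ)) (𝓝 0)) := by
  induction k with
  | zero => simpa using ⟨hd, hb, hc⟩
  | succ k ih =>
    obtain ⟨hd', hb', hc'⟩ := ih
    simp only [Function.iterate_succ_apply']
    exact cfi_dslope_package hd' hb' hc'

/-- **Vanishing coefficient limits.**  If `G δ` is entire for all small `δ > 0`, bounded on every
closed ball eventually in `δ`, and `G δ t → 0` as `δ → 0⁺` for every REAL `t`, then every Taylor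
coefficient `(G δ)^{(k)}(0)` tends to `0`: the package `cfi_iterate_package` for the `k`-th
iterated divided difference, `cfi_tendsto_zero_origin` for its value at `0`, and
`iteratedDeriv k (G δ) 0 = k! · (swap dslope 0)^[k] (G δ) 0` (`vitaliCoeff_iteratedDeriv_eq`). -/
theorem cfi_tendsto_iteratedDeriv_zero {G : ℝ → ℂ → ℂ}
    (hd : ∀ᶠ δ in 𝓝[>] (0 : ℝ), Differentiable ℂ (G δ))
    (hb : ∀ ρ : ℝ, 0 < ρ → ∃ M : ℝ, ∀ᶠ δ in 𝓝[>] (0 : ℝ), ∀ t : ℂ, ‖t‖ ≤ ρ → ‖G δ t‖ ≤ M)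
    (hc : ∀ t : ℝ, Tendsto (fun δ ↦ G δ (t : ℂ)) (𝓝[>] (0 : ℝ)) (𝓝 0)) (k : ℕ) :
    Tendsto (fun δ ↦ iteratedDeriv k (G δ) 0) (𝓝[>] (0 : ℝ)) (𝓝 0) := by
  obtain ⟨hd', hb', hc'⟩ := cfi_iterate_package hd hb (fun t _ ↦ hc t) k
  have h0 := (cfi_tendsto_zero_origin hd' hb' hc').const_mul (k.factorial : ℂ)
  rw [mul_zero] at h0
  refine h0.congr' ?_
  filter_upwards [hd] with δ hδ
  exact (vitaliCoeff_iteratedDeriv_eq hδ k).symm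

/-- **Coefficients from real-axis limits.**  If `Φ δ` is entire for all small `δ > 0`, bounded on
every closed ball eventually in `δ`, and `Φ δ t → g t` as `δ → 0⁺` for every REAL `t`, with `g`
entire, then `(Φ δ)^{(k)}(0) → g^{(k)}(0)` for every `k`: apply `cfi_tendsto_iteratedDeriv_zero` to
the difference family `Φ δ − g` (entire; bounded on closed balls since `g` is,
`IsCompact.exists_bound_of_continuousOn`; tending to `0` on the real axis) and use
`iteratedDeriv_fun_sub`. -/
theorem cfi_tendsto_iteratedDeriv_of_tendsto_real {Φ : ℝ → ℂ → ℂ} {g : ℂ → ℂ}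
    (hd : ∀ᶠ δ in 𝓝[>] (0 : ℝ), Differentiable ℂ (Φ δ))
    (hb : ∀ ρ : ℝ, 0 < ρ → ∃ M : ℝ, ∀ᶠ δ in 𝓝[>] (0 : ℝ), ∀ t : ℂ, ‖t‖ ≤ ρ → ‖Φ δ t‖ ≤ M)
    (hg : Differentiable ℂ g)
    (hc : ∀ t : ℝ, Tendsto (fun δ ↦ Φ δ (t : ℂ)) (𝓝[>] (0 : ℝ)) (𝓝 (g t))) (k : ℕ) :
    Tendsto (fun δ ↦ iteratedDeriv k (Φ δ) 0) (𝓝[>] (0 : ℝ)) (𝓝 (iteratedDeriv k g 0)) := by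
  -- the difference family `D δ = Φ δ - g`
  have hdD : ∀ᶠ δ in 𝓝[>] (0 : ℝ), Differentiable ℂ (fun t ↦ Φ δ t - g t) := by
    filter_upwards [hd] with δ hδ using hδ.sub hg
  have hbD : ∀ ρ : ℝ, 0 < ρ → ∃ M : ℝ, ∀ᶠ δ in 𝓝[>] (0 : ℝ), ∀ t : ℂ, ‖t‖ ≤ ρ →
      ‖Φ δ t - g t‖ ≤ M := by
    intro ρ hρ
    obtain ⟨M, hM⟩ := hb ρ hρ
    obtain ⟨K, hK⟩ :=
      (isCompact_closedBall (0 : ℂ) ρ).exists_bound_of_continuousOn hg.continuous.continuousOn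
    refine ⟨M + K, ?_⟩
    filter_upwards [hM] with δ hMδ t ht
    exact (norm_sub_le _ _).trans (add_le_add (hMδ t ht) (hK t (mem_closedBall_zero_iff.2 ht)))
  have hcD : ∀ t : ℝ, Tendsto (fun δ ↦ Φ δ (t : ℂ) - g t) (𝓝[>] (0 : ℝ)) (𝓝 0) := fun t ↦ by
    rw [← sub_self (g t)]
    exact (hc t).sub_const (g t)
  have hD := cfi_tendsto_iteratedDeriv_zero (G := fun δ t ↦ Φ δ t - g t) hdD hbD hcD k
  have heq : ∀ᶠ δ in 𝓝[>] (0 : ℝ), iteratedDeriv k (fun t ↦ Φ δ t - g t) 0 =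
      iteratedDeriv k (Φ δ) 0 - iteratedDeriv k g 0 := by
    filter_upwards [hd] with δ hδ
    exact iteratedDeriv_fun_sub hδ.contDiff.contDiffAt hg.contDiff.contDiffAt
  exact tendsto_sub_nhds_zero_iff.1 (hD.congr' heq)

/-- **Pointwise limits from the first two coefficients and the coefficient limits of orders `≥ 2`.**
If `F δ` is entire for all small `δ > 0`, bounded on every closed ball eventually in `δ`, `G` is
entire, `F δ 0 = G 0` and `(F δ)'(0) = G'(0)` for all small `δ > 0`, and `(F δ)^{(k)}(0) → G^{(k)}(0)`
for every `k ≥ 2`, then `F δ t → G t` for every `t ∈ ℂ` (`stub_taylorLimit`). -/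
theorem cfi_tendsto_of_coefficients {F : ℝ → ℂ → ℂ} {G : ℂ → ℂ}
    (hd : ∀ᶠ δ in 𝓝[>] (0 : ℝ), Differentiable ℂ (F δ)) (hG : Differentiable ℂ G)
    (hb : ∀ ρ : ℝ, 0 < ρ → ∃ M : ℝ, ∀ᶠ δ in 𝓝[>] (0 : ℝ), ∀ t : ℂ, ‖t‖ ≤ ρ → ‖F δ t‖ ≤ M)
    (h0 : ∀ᶠ δ in 𝓝[>] (0 : ℝ), F δ 0 = G 0)
    (h1 : ∀ᶠ δ in 𝓝[>] (0 : ℝ), deriv (F δ) 0 = deriv G 0)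
    (h2 : ∀ k : ℕ, 2 ≤ k →
      Tendsto (fun δ ↦ iteratedDeriv k (F δ) 0) (𝓝[>] (0 : ℝ)) (𝓝 (iteratedDeriv k G 0)))
    (t : ℂ) : Tendsto (fun δ ↦ F δ t) (𝓝[>] (0 : ℝ)) (𝓝 (G t)) := by
  refine stub_taylorLimit F G hd hG hb (fun k ↦ ?_) t
  match k with
  | 0 =>
      simp only [iteratedDeriv_zero]
      exact (tendsto_const_nhds (x := G 0)).congr' (h0.mono fun δ hδ ↦ hδ.symm)
  | 1 =>
      simp only [iteratedDeriv_one]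
      exact (tendsto_const_nhds (x := deriv G 0)).congr' (h1.mono fun δ hδ ↦ hδ.symm)
  | k + 2 => exact h2 (k + 2) (by omega)

/-! ## Small glue facts -/

/-- Admissibility is stable under real scaling of the density: `t·f` is admissible with constant
`|t|·C`. -/
theorem cfi_admissible_smul {f : ℂ → ℝ} {R C : ℝ} (hf : Measurable f) (hC : ∀ z, |f z| ≤ C)
    (hR : ∀ z, R < ‖z‖ → f z = 0) (h0 : ∫ z, f z = 0) (t : ℝ) :
    Measurable (fun z ↦ t * f z) ∧ (∀ z, |t * f z| ≤ |t| * C) ∧ (∀ z, R < ‖z‖ → t * f z = 0) ∧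
      ∫ z, t * f z = 0 := by
  refine ⟨hf.const_mul t, fun z ↦ ?_, fun z hz ↦ by rw [hR z hz, mul_zero], ?_⟩
  · rw [abs_mul]
    exact mul_le_mul_of_nonneg_left (hC z) (abs_nonneg t)
  · rw [integral_const_mul, h0, mul_zero]

/-- The logarithmic energy is quadratic in the density:
`∬ log‖x−y‖ (t f)(x) (t f)(y) = t² ∬ log‖x−y‖ f(x) f(y)`. -/
theorem cfi_logIntegral_smul (f : ℂ → ℝ) (t : ℝ) :
    ∫ x, ∫ y, Real.log ‖x - y‖ * (t * f x) * (t * f y) =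
      t ^ 2 * ∫ x, ∫ y, Real.log ‖x - y‖ * f x * f y := by
  have h : ∀ x y : ℂ, Real.log ‖x - y‖ * (t * f x) * (t * f y) =
      t ^ 2 * (Real.log ‖x - y‖ * f x * f y) := fun x y ↦ by ring
  simp_rw [h, integral_const_mul]

/-- `d/dt exp(c t²) = 0` at `t = 0`. -/
theorem cfi_deriv_cexp_mul_sq_zero (c : ℂ) : deriv (fun t : ℂ ↦ Complex.exp (c * t ^ 2)) 0 = 0 := by
  have h1 : HasDerivAt (fun t : ℂ ↦ c * t ^ 2) (c * (↑(2 : ℕ) * (0 : ℂ) ^ (2 - 1))) 0 :=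
    (hasDerivAt_pow 2 (0 : ℂ)).const_mul _
  rw [h1.cexp.deriv]
  simp

/-! ## The two directions in tree vocabulary -/

section Directions

variable {f : ℂ → ℝ} {R C : ℝ}

/-- **The crux gives the limit of `Φ_δ(t)` at every REAL coupling `t`**: `t·f` is admissible
(`cfi_admissible_smul`), `q(t·f) = t² q(f)` (`cfi_logIntegral_smul`), the crux's expectation for `t·f`
is `Λ^𝕋_δ(t·f)` (`Theorems.integral_site_eq`), which is `Φ_δ(t)` (`stub_entire`). -/
theorem cfi_tendsto_ofReal_of_magicFormulaT
    (hM : Summit.CriticalPhenomena.CardyFormulaZ2.Theses.CardyMagicRigidity.MagicFormulaT)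
    (hf : Measurable f) (hC : ∀ z, |f z| ≤ C) (hR : ∀ z, R < ‖z‖ → f z = 0) (h0 : ∫ z, f z = 0)
    (t : ℝ) :
    Tendsto (fun δ : ℝ ↦ ∫ ω, (∏ᶠ u ∈ (siteLoopConfig δ ω).loops,
        2 * Complex.cos ((t : ℂ) * ((u.nestingPhase f : ℝ) : ℂ) + (Real.pi : ℂ) / 3))
          ∂(triSitePercolation half))
      (𝓝[>] (0 : ℝ)) (𝓝 (Complex.exp
        (((3 / (4 * π ^ 2) * ∫ x, ∫ y, Real.log ‖x - y‖ * f x * f y : ℝ) : ℂ) * (t : ℂ) ^ 2))) := by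
  obtain ⟨hm, hb, hs, hi⟩ := cfi_admissible_smul hf hC hR h0 t
  have h1 := hM (fun z ↦ t * f z) R (|t| * C) hm hb hs hi
  have h2 : Tendsto (fun δ : ℝ ↦
      truncNestingTransform (triSitePercolation half) (siteLoopConfig δ) (fun z ↦ t * f z) 0)
      (𝓝[>] (0 : ℝ)) (𝓝 (Real.exp (3 / (4 * Real.pi ^ 2) *
        ∫ x, ∫ y, Real.log ‖x - y‖ * (t * f x) * (t * f y)))) :=
    h1.congr' (Eventually.of_forall fun δ ↦ Theorems.integral_site_eq (fun z ↦ t * f z) δ)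
  rw [cfi_logIntegral_smul] at h2
  have h3 := (Complex.continuous_ofReal.tendsto _).comp h2
  have hlim : ((Real.exp (3 / (4 * Real.pi ^ 2) *
      (t ^ 2 * ∫ x, ∫ y, Real.log ‖x - y‖ * f x * f y)) : ℝ) : ℂ) =
      Complex.exp (((3 / (4 * π ^ 2) * ∫ x, ∫ y, Real.log ‖x - y‖ * f x * f y : ℝ) : ℂ) *
        (t : ℂ) ^ 2) := by
    rw [Complex.ofReal_exp]
    push_cast
    ring_nf
  rw [hlim] at h3
  have hpos : ∀ᶠ δ in 𝓝[>] (0 : ℝ), 0 < δ := self_mem_nhdsWithin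
  refine h3.congr' ?_
  filter_upwards [hpos] with δ hδ
  exact ((stub_entire f R C hf hC hR h0 δ hδ).2.2.2 t).symm

/-- **Direction `→`: the crux identifies every Taylor coefficient.**  From
`cfi_tendsto_ofReal_of_magicFormulaT` (limits on the real axis), `stub_entire`, `stub_normalFamily`
and `cfi_tendsto_iteratedDeriv_of_tendsto_real`. -/
theorem cfi_coefficients_of_magicFormulaT
    (hM : Summit.CriticalPhenomena.CardyFormulaZ2.Theses.CardyMagicRigidity.MagicFormulaT)
    (hf : Measurable f) (hC : ∀ z, |f z| ≤ C) (hR : ∀ z, R < ‖z‖ → f z = 0) (h0 : ∫ z, f z = 0)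
    (k : ℕ) :
    Tendsto (fun δ : ℝ ↦ iteratedDeriv k (fun t : ℂ ↦ ∫ ω, (∏ᶠ u ∈ (siteLoopConfig δ ω).loops,
      2 * Complex.cos (t * ((u.nestingPhase f : ℝ) : ℂ) + (Real.pi : ℂ) / 3)) ∂(triSitePercolation half)) 0)
      (𝓝[>] (0 : ℝ)) (𝓝 (iteratedDeriv k (fun t : ℂ ↦ Complex.exp
        (((3 / (4 * π ^ 2) * ∫ x, ∫ y, Real.log ‖x - y‖ * f x * f y : ℝ) : ℂ) * t ^ 2)) 0)) := by
  have hpos : ∀ᶠ δ in 𝓝[>] (0 : ℝ), 0 < δ := self_mem_nhdsWithin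
  refine cfi_tendsto_iteratedDeriv_of_tendsto_real
    (Φ := fun (δ : ℝ) (t : ℂ) ↦ ∫ ω, (∏ᶠ u ∈ (siteLoopConfig δ ω).loops,
      2 * Complex.cos (t * ((u.nestingPhase f : ℝ) : ℂ) + (Real.pi : ℂ) / 3)) ∂(triSitePercolation half))
    (g := fun t : ℂ ↦ Complex.exp
      (((3 / (4 * π ^ 2) * ∫ x, ∫ y, Real.log ‖x - y‖ * f x * f y : ℝ) : ℂ) * t ^ 2))
    ?_ (stub_normalFamily f R C hf hC hR h0) (by fun_prop)
    (cfi_tendsto_ofReal_of_magicFormulaT hM hf hC hR h0) k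
  filter_upwards [hpos] with δ hδ using (stub_entire f R C hf hC hR h0 δ hδ).1

end Directions

section Converse

variable {f : ℂ → ℝ} {R C : ℝ}

/-- **Direction `←`: the identification of the coefficients of orders `≥ 2` gives the limit of the
real transform.**  Orders `0` (`Φ_δ(0) = 1`, `stub_entire`) and `1` (`Φ_δ'(0) = 0`, exact centring
`smearedCentring`; `G_f'(0) = 0`) hold at every mesh; `cfi_tendsto_of_coefficients` (i.e.
`stub_taylorLimit` on the normal family `stub_entire` / `stub_normalFamily`) gives `Φ_δ(1) → G_f(1)`;
at the real coupling `t = 1` this is `Λ^𝕋_δ(f) → G(f)` (`stub_entire`'s real identity, real parts). -/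
theorem cfi_tendsto_transform_of_coefficients (hf : Measurable f) (hC : ∀ z, |f z| ≤ C)
    (hR : ∀ z, R < ‖z‖ → f z = 0) (h0 : ∫ z, f z = 0)
    (hI : ∀ k : ℕ, 2 ≤ k →
      Tendsto (fun δ : ℝ ↦ iteratedDeriv k (fun t : ℂ ↦ ∫ ω, (∏ᶠ u ∈ (siteLoopConfig δ ω).loops,
        2 * Complex.cos (t * ((u.nestingPhase f : ℝ) : ℂ) + (Real.pi : ℂ) / 3)) ∂(triSitePercolation half)) 0)
        (𝓝[>] (0 : ℝ)) (𝓝 (iteratedDeriv k (fun t : ℂ ↦ Complex.exp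
          (((3 / (4 * π ^ 2) * ∫ x, ∫ y, Real.log ‖x - y‖ * f x * f y : ℝ) : ℂ) * t ^ 2)) 0))) :
    Tendsto (fun δ : ℝ ↦ truncNestingTransform (triSitePercolation half) (siteLoopConfig δ) f 0)
      (𝓝[>] (0 : ℝ)) (𝓝 (Real.exp (3 / (4 * π ^ 2) * ∫ x, ∫ y, Real.log ‖x - y‖ * f x * f y))) := by
  have hpos : ∀ᶠ δ in 𝓝[>] (0 : ℝ), 0 < δ := self_mem_nhdsWithin
  have hE := fun (δ : ℝ) (hδ : 0 < δ) ↦ stub_entire f R C hf hC hR h0 δ hδ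
  -- the normal family converges to the Gaussian at every coupling, in particular at `t = 1`
  have hlim := cfi_tendsto_of_coefficients
    (F := fun (δ : ℝ) (t : ℂ) ↦ ∫ ω, (∏ᶠ u ∈ (siteLoopConfig δ ω).loops,
      2 * Complex.cos (t * ((u.nestingPhase f : ℝ) : ℂ) + (Real.pi : ℂ) / 3)) ∂(triSitePercolation half))
    (G := fun t : ℂ ↦ Complex.exp
      (((3 / (4 * π ^ 2) * ∫ x, ∫ y, Real.log ‖x - y‖ * f x * f y : ℝ) : ℂ) * t ^ 2))
    (by filter_upwards [hpos] with δ hδ using (hE δ hδ).1) (by fun_prop)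
    (stub_normalFamily f R C hf hC hR h0)
    (by
      filter_upwards [hpos] with δ hδ
      exact (hE δ hδ).2.1.trans (by simp))
    (by
      filter_upwards [hpos] with δ hδ
      rw [(hE δ hδ).2.2.1, smearedCentring half f R C δ hf hC hR h0 hδ, cfi_deriv_cexp_mul_sq_zero]
      simp)
    hI 1
  -- back to the real transform at coupling `1`
  have hlim' : Tendsto (fun δ : ℝ ↦
      ((truncNestingTransform (triSitePercolation half) (siteLoopConfig δ) f 0 : ℝ) : ℂ))
      (𝓝[>] (0 : ℝ))
      (𝓝 (((Real.exp (3 / (4 * π ^ 2) * ∫ x, ∫ y, Real.log ‖x - y‖ * f x * f y)) : ℝ) : ℂ)) := by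
    have hone : (((Real.exp (3 / (4 * π ^ 2) * ∫ x, ∫ y, Real.log ‖x - y‖ * f x * f y)) : ℝ) : ℂ) =
        (fun t : ℂ ↦ Complex.exp (((3 / (4 * π ^ 2) *
          ∫ x, ∫ y, Real.log ‖x - y‖ * f x * f y : ℝ) : ℂ) * t ^ 2)) 1 := by
      simp [Complex.ofReal_exp]
    rw [hone]
    refine hlim.congr' ?_
    filter_upwards [hpos] with δ hδ
    have h1 := (hE δ hδ).2.2.2 1
    simp only [Complex.ofReal_one, one_mul] at h1
    simpa using h1
  have key := (Complex.continuous_re.tendsto _).comp hlim'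
  simpa only [Function.comp_def, Complex.ofReal_re] using key

end Converse

/-! ## The registered sub-goal -/

/-- **Sub-goal CF-d (`cf_magicFormulaT_iff_coefficients`) · the coefficient residue of line `Sketch`
v8.**  Given the two published leaves (Camia–Newman's full-plane CLE₆ limit and Smirnov–Werner's
four-arm scaling limit; hypotheses of the registered signature, not used by the proof), the crux
`MagicFormulaT` is EQUIVALENT to: for every admissible density `f` and every `k ≥ 2`, the `k`-th
Taylor coefficient at `t = 0` of `Φ_δ(t) = E_{1/2}[∏_u 2cos(t·θ_u(f) + π/3)]` converges, as `δ → 0⁺`,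
to that of `G_f(t) = exp(q(f) t²)`.  `→`: `cfi_coefficients_of_magicFormulaT`; `←`:
`cfi_tendsto_transform_of_coefficients` and `Theorems.integral_site_eq`. -/
theorem cf_magicFormulaT_iff_coefficients : exists_isFullPlaneCNLLaw → SmirnovWerner2001_fourArm_scalingLimit →
    (Summit.CriticalPhenomena.CardyFormulaZ2.Theses.CardyMagicRigidity.MagicFormulaT ↔
      ∀ (f : ℂ → ℝ) (R C : ℝ), Measurable f → (∀ z, |f z| ≤ C) → (∀ z, R < ‖z‖ → f z = 0) → ∫ z, f z = 0 →
      ∀ k : ℕ, 2 ≤ k → Tendsto (fun δ : ℝ ↦ iteratedDeriv k (fun t : ℂ ↦ ∫ ω, (∏ᶠ u ∈ (siteLoopConfig δ ω).loops,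
        2 * Complex.cos (t * ((u.nestingPhase f : ℝ) : ℂ) + (Real.pi : ℂ) / 3)) ∂(triSitePercolation half)) 0)
        (𝓝[>] (0 : ℝ)) (𝓝 (iteratedDeriv k (fun t : ℂ ↦ Complex.exp
          (((3 / (4 * π ^ 2) * ∫ x, ∫ y, Real.log ‖x - y‖ * f x * f y : ℝ) : ℂ) * t ^ 2)) 0))) := by
  intro _ _
  constructor
  · intro hM _ _ _ hf hC hR h0 k _
    exact cfi_coefficients_of_magicFormulaT hM hf hC hR h0 k
  · intro hI f R C hf hC hR h0
    exact (cfi_tendsto_transform_of_coefficients hf hC hR h0 (hI f R C hf hC hR h0)).congr'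
      (Eventually.of_forall fun δ ↦ (Theorems.integral_site_eq f δ).symm)

end Summit.CriticalPhenomena.CardyFormulaZ2.Cruxes.MagicFormulaT.LineSketch

end
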